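import Summits.PneNP.PneNP.Theses.Kloosterman
import Literature.Computability.Complexity.CodeFPModArith
import Literature.Computability.Complexity.SearchToDecision
import Literature.Computability.Complexity.PRelHierarchy
import Literature.Computability.Cryptography.OneWayFunctionsPneNP

/-!
# Route Kloosterman — `WorstCaseToSummit` (stmt-PneNP-2579)

Glue `W → PneNP`: if no `FP` function finds small square roots modulo a product of given primes whenever one
exists (`SqfreeRootSearchHard`), then `P ≠ NP`. Contrapositive: `¬ PneNP ⇒ NP ⊆ P`
(`pneNP_shape_of_NP_not_subset_P`, proved bridges inside); the solution relation
`R = {⟨x, y⟩ | decodeNat y ≤ c ∧ (decodeNat y)² ≡ a [MOD ∏ S]}` (instance `x = ⟨code S, ⟨bin a, bin c⟩⟩`) is in `P`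
(typed `CodeFP` program: list product by a fold, modular squaring, comparisons; the certificate is canonicalised
with `canonF`, so EVERY string `y` is read as the numeral `decodeNat y`), and it is polynomially balanced
(`|bin z| ≤ |bin c| ≤ |x|` for `z ≤ c`); Arora–Barak's Thm. 2.18 (`exists_searchFn_of_NP_subset_P`) then yields
the forbidden worst-case solver.
-/

set_option linter.dupNamespace false -- `Summit.PneNP.PneNP.…`: summit = sub-problem name (D-0017 single-conjunct layout)

namespace Summit.PneNP.PneNP.Theorems

open _root_.Computability Polynomial
open Literature.Computability.Complexity Literature.Computability.Complexity.CodeFP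
  Literature.Computability.Complexity.Brick

/-- The product of a list of numerals is computed on codes in polynomial time (left fold; the accumulator is at
most one symbol longer than the list code). [cite: AroraBarak2009, §1.3] [folklore] -/
theorem kloosterman_codeFP_listProd : CodeFP (listE natE) natE List.prod := by
  have hstep : CodeFP (pairE natE natE) natE (fun t : ℕ × ℕ => t.2 * t.1) :=
    natMul.comp ((CodeFP.snd natE natE).pair (CodeFP.fst natE natE))
  have hfold : CodeFP (rawE natE) natE (fun l : List ℕ => l.foldl (fun b a => b * a) 1) := by
    refine foldl₀ (step := fun a b => b * a) (b₀ := 1) hstep (X + 1) fun l₁ l₂ => ?_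
    rw [← List.prod_eq_foldl, eval_add, eval_X, eval_one]
    have h1 := length_natE_le_of_lt (prod_lt_two_pow_length_rawE_succ l₁)
    have h2 : (rawE natE l₁).length ≤ (rawE natE (l₁ ++ l₂)).length := by
      rw [rawE_append, List.length_append]; omega
    omega
  exact ((hfold.congr fun l => (List.prod_eq_foldl (xs := l)).symm).comp (rawOfList natE) :)

/-- The typed test of the solution relation: on `((S, a, c), z)`, the bit `[z ≤ c ∧ z² ≡ a (mod ∏ S)]`, computed on
codes in polynomial time. [cite: AroraBarak2009, §1.3] [folklore] -/
theorem kloosterman_codeFP_rootTest :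
    CodeFP (pairE (pairE (listE natE) (pairE natE natE)) natE) bitE
      fun t : (List ℕ × (ℕ × ℕ)) × ℕ => decide (t.2 ≤ t.1.2.2) && decide (t.2 * t.2 % t.1.1.prod = t.1.2.1 % t.1.1.prod) := by
  have hS : CodeFP (pairE (pairE (listE natE) (pairE natE natE)) natE) (listE natE)
      fun t : (List ℕ × (ℕ × ℕ)) × ℕ => t.1.1 := (CodeFP.fst _ _).fst'
  have ha : CodeFP (pairE (pairE (listE natE) (pairE natE natE)) natE) natE
      fun t : (List ℕ × (ℕ × ℕ)) × ℕ => t.1.2.1 := (CodeFP.fst _ _).snd'.fst'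
  have hc : CodeFP (pairE (pairE (listE natE) (pairE natE natE)) natE) natE
      fun t : (List ℕ × (ℕ × ℕ)) × ℕ => t.1.2.2 := (CodeFP.fst _ _).snd'.snd'
  have hz : CodeFP (pairE (pairE (listE natE) (pairE natE natE)) natE) natE
      fun t : (List ℕ × (ℕ × ℕ)) × ℕ => t.2 := CodeFP.snd _ _
  have hN : CodeFP (pairE (pairE (listE natE) (pairE natE natE)) natE) natE
      fun t : (List ℕ × (ℕ × ℕ)) × ℕ => t.1.1.prod := (kloosterman_codeFP_listProd.comp hS :)
  have h1 : CodeFP (pairE (pairE (listE natE) (pairE natE natE)) natE) bitE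
      fun t : (List ℕ × (ℕ × ℕ)) × ℕ => decide (t.2 ≤ t.1.2.2) := (natLe.comp (hz.pair hc) :)
  have h2 : CodeFP (pairE (pairE (listE natE) (pairE natE natE)) natE) bitE
      fun t : (List ℕ × (ℕ × ℕ)) × ℕ => decide (t.2 * t.2 % t.1.1.prod = t.1.2.1 % t.1.1.prod) :=
    (natEq.comp ((modOf hN (natMul.comp (hz.pair hz) :)).pair (modOf hN ha)) :)
  exact h1.and h2

/-- **The solution relation is in `P` and reads every certificate as a numeral**: a language `R ∈ P` with
`⟨⟨code S, ⟨bin a, bin c⟩⟩, y⟩ ∈ R ↔ decodeNat y ≤ c ∧ (decodeNat y)² ≡ a [MOD ∏ S]` for ALL strings `y`.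
[cite: AroraBarak2009, Def. 1.13] [folklore] -/
theorem kloosterman_exists_rootRel :
    ∃ R : Language Bool, R ∈ Classes.P ∧ ∀ (S : List ℕ) (a c : ℕ) (y : List Bool),
      boolPair (boolPair (encodingListNatBool.encode S) (boolPair (encodeNat a) (encodeNat c))) y ∈ R ↔
        decodeNat y ≤ c ∧ decodeNat y ^ 2 ≡ a [MOD S.prod] := by
  obtain ⟨f, hf, hfQ⟩ := kloosterman_codeFP_rootTest
  refine ⟨(f ∘ fanoutFn fstF (canonF ∘ sndF)) ⁻¹' PRelSigma.HeadIs true,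
    preimage_mem_P (PRelSigma.HeadIs_mem_P true)
      (comp_mem_FP hf (fanoutFn_mem_FP fstF_mem_FP (comp_mem_FP canonF_mem_FP sndF_mem_FP))), fun S a c y => ?_⟩
  have hfx := hfQ ((S, (a, c)), decodeNat y)
  simp only [pairE_apply] at hfx
  change (f ∘ fanoutFn fstF (canonF ∘ sndF))
      (boolPair (boolPair (encodingListNatBool.encode S) (boolPair (encodeNat a) (encodeNat c))) y) ∈
    PRelSigma.HeadIs true ↔ _
  simp only [Function.comp_apply, fanoutFn_apply, fstF_boolPair, sndF_boolPair, canonF_eq_encodeNat_decodeNat,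
    PRelSigma.mem_HeadIs]
  rw [show encodingListNatBool.encode S = listE natE S from congrFun (listE_eq encodingNatBool) S, hfx]
  simp only [bitE, List.head?_cons, Option.some.injEq, Bool.and_eq_true, decide_eq_true_eq, Nat.ModEq, pow_two]

/-- **Glue `W → PneNP` of route Kloosterman (stmt-PneNP-2579)**: `SqfreeRootSearchHard → PneNP`. Under `¬ PneNP`,
`NP ⊆ P` and search reduces to decision (`exists_searchFn_of_NP_subset_P`, certificate bound `p = X`:
`|bin z| ≤ |bin c| ≤ |x|`), giving an `FP` solver for the square-root relation — which `W` forbids.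
[cite: AroraBarakCC2009, Thm. 2.18] [cite: Goldreich2001, §2.7.4 Exercise 2] -/
theorem kloosterman_worstCaseToSummit_proof : Summit.PneNP.PneNP.Theses.Kloosterman.WorstCaseToSummit := by
  intro hW
  by_contra hne
  have hNP : Nondeterministic.NP ⊆ Classes.P := by
    by_contra h
    exact hne (Literature.Computability.Cryptography.pneNP_shape_of_NP_not_subset_P h)
  obtain ⟨R, hR, hRiff⟩ := kloosterman_exists_rootRel
  obtain ⟨g, hg, hspec⟩ := exists_searchFn_of_NP_subset_P hNP hR X
  apply hW
  refine ⟨g, hg, fun S a c hsort hprime hex => ?_⟩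
  obtain ⟨z, hzc, hza⟩ := hex
  set x := boolPair (encodingListNatBool.encode S) (boolPair (encodeNat a) (encodeNat c)) with hxdef
  have hy : ∃ y : List Bool, y.length ≤ X.eval x.length ∧ boolPair x y ∈ R := by
    refine ⟨encodeNat z, ?_, (hRiff S a c _).2 ?_⟩
    · rw [eval_X, hxdef, length_boolPair, length_boolPair]
      have : (encodeNat z).length ≤ (encodeNat c).length := length_natE_mono hzc
      omega
    · rw [Computability.decode_encodeNat]
      exact ⟨hzc, hza⟩
  exact (hRiff S a c _).1 (hspec x hy).2

end Summit.PneNP.PneNP.Theorems
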